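import Mathlib

/-!
# Symplectic leakage: Lie subalgebras annihilated by `μ` are isotropic for the Kirillov form

Solo-blind seat (MatrixMultiplication), companion note `LieExponent.md`, §3.17 (Lemma 3.17(b) and
Theorem 5, the "Kirillov packing bound": for every real Lie group `G` and every TPP triple of
connected Lie subgroups, `dim H₁ + dim H₂ + dim H₃ ≤ (3 dim G − ind 𝔤)/2`, so that no TPP / K-TPP
construction with Lie subgroups certifies a Lie exponent below `3` in the sense of
Blasiak–Cohn–Grochow–Pratt–Umans, arXiv:2204.03826, Def. 4.1 / Lemma 4.8, in any reductive group).

The load-bearing linear-algebra step, proved here over an arbitrary field: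

* `soloLie_two_mul_finrank_le_of_le_orthogonal`: if `W ≤ W^⊥` for a bilinear form `B` on a
  finite-dimensional space `V`, then `2 · dim W ≤ dim V + dim (W ∩ ker B)`;
* `soloLie_isotropic_finrank_bound`: for a REFLEXIVE form (e.g. alternating or symmetric) and a
  totally isotropic subspace `U`, `2 · dim U + dim (ker B) ≤ dim V + 2 · dim (U ∩ ker B)`, i.e.
  `dim U − dim (U ∩ rad B) ≤ (dim V − dim rad B)/2` (apply the first bound to `U + ker B`);
* `soloLie_mem_ker_kirillov_iff`, `soloLie_kirillov_leakage`: for a finite-dimensional Lie algebra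
  `L`, a linear form `μ`, and any bilinear form `B` with `B x y = μ ⁅x, y⁆` (the Kirillov form;
  it is alternating, its kernel is the coadjoint stabiliser `L^μ = {x | ∀ y, μ ⁅x, y⁆ = 0}`), every
  Lie subalgebra `H` with `μ|_H = 0` is totally isotropic (`[H, H] ⊆ H ⊆ ker μ`), hence
  `2 · dim H + dim L^μ ≤ dim L + 2 · dim (H ∩ L^μ)`:
  the subalgebra meets the stabiliser in dimension at least `dim H − (dim L − dim L^μ)/2`.
  For `L = 𝔤𝔩ₙ` and `μ = tr(Λ ·)` this is Step 4 of Theorem 4 (`GL₃`) for all `n` at once.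
-/

set_option linter.dupNamespace false

namespace Summit.MatrixMultiplication.MatrixMultiplication.Theorems

open Module

section BilinForm

variable {K V : Type*} [Field K] [AddCommGroup V] [Module K V] [FiniteDimensional K V]

/-- If a subspace `W` is contained in its own (right) orthogonal for a bilinear form `B`, then
`2 · dim W ≤ dim V + dim (W ∩ ker B)`.  [elementary; from Mathlib's
`finrank_add_finrank_orthogonal'`] -/
theorem soloLie_two_mul_finrank_le_of_le_orthogonal (B : LinearMap.BilinForm K V)
    (W : Submodule K V) (hW : W ≤ B.orthogonal W) :
    2 * finrank K W ≤ finrank K V + finrank K (W ⊓ LinearMap.ker B : Submodule K V) := by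
  have h1 := LinearMap.BilinForm.finrank_add_finrank_orthogonal' (B := B) W
  have h2 : finrank K W ≤ finrank K (B.orthogonal W) := Submodule.finrank_mono hW
  omega

/-- **Isotropic subspaces versus the radical.**  For a reflexive bilinear form `B` on a
finite-dimensional vector space `V` and a totally isotropic subspace `U` (`B x y = 0` for
`x, y ∈ U`): `2 · dim U + dim (ker B) ≤ dim V + 2 · dim (U ∩ ker B)`, i.e.
`dim U − dim (U ∩ rad) ≤ (dim V − dim rad)/2`.  [elementary symplectic linear algebra] -/
theorem soloLie_isotropic_finrank_bound (B : LinearMap.BilinForm K V) (hB : B.IsRefl)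
    (U : Submodule K V) (hU : ∀ x ∈ U, ∀ y ∈ U, B x y = 0) :
    2 * finrank K U + finrank K (LinearMap.ker B) ≤
      finrank K V + 2 * finrank K (U ⊓ LinearMap.ker B : Submodule K V) := by
  set R : Submodule K V := LinearMap.ker B with hR
  -- elements of the (left) kernel pair to zero with everything, on both sides (reflexivity)
  have hR0 : ∀ r ∈ R, ∀ z, B r z = 0 := by
    intro r hr z
    have h0 : B r = 0 := LinearMap.mem_ker.1 hr
    rw [h0]; rfl
  have hR0' : ∀ r ∈ R, ∀ z, B z r = 0 := fun r hr z => hB _ _ (hR0 r hr z)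
  -- `U + R` is again isotropic
  have hiso : U ⊔ R ≤ B.orthogonal (U ⊔ R) := by
    intro m hm
    rw [LinearMap.BilinForm.mem_orthogonal_iff]
    intro n hn
    obtain ⟨u, hu, r, hr, rfl⟩ := Submodule.mem_sup.1 hm
    obtain ⟨u', hu', r', hr', rfl⟩ := Submodule.mem_sup.1 hn
    have e1 : B u' u = 0 := hU u' hu' u hu
    have e2 : B u' r = 0 := hR0' r hr u'
    have e3 : B r' u = 0 := hR0 r' hr' u
    have e4 : B r' r = 0 := hR0 r' hr' r
    simp only [map_add, LinearMap.add_apply, e1, e2, e3, e4, add_zero]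
  have hA := soloLie_two_mul_finrank_le_of_le_orthogonal B (U ⊔ R) hiso
  have hinf : ((U ⊔ R) ⊓ LinearMap.ker B : Submodule K V) = R :=
    inf_eq_right.2 le_sup_right
  rw [hinf] at hA
  have hsup := Submodule.finrank_sup_add_finrank_inf_eq U R
  omega

end BilinForm

section Lie

variable {K L : Type*} [Field K] [LieRing L] [LieAlgebra K L] [FiniteDimensional K L]

omit [FiniteDimensional K L] in
/-- The kernel of the Kirillov form `B x y = μ ⁅x, y⁆` is the coadjoint stabiliser
`L^μ = {x | ∀ y, μ ⁅x, y⁆ = 0}`. [definition unfolding] -/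
theorem soloLie_mem_ker_kirillov_iff (μ : Module.Dual K L) (B : LinearMap.BilinForm K L)
    (hB : ∀ x y, B x y = μ ⁅x, y⁆) (x : L) :
    x ∈ LinearMap.ker B ↔ ∀ y, μ ⁅x, y⁆ = 0 := by
  rw [LinearMap.mem_ker, LinearMap.ext_iff]
  simp only [hB, LinearMap.zero_apply]

/-- **Symplectic leakage (LieExponent.md, Lemma 3.17(b)).**  Let `L` be a finite-dimensional Lie
algebra over a field `K`, `μ` a linear form on `L`, `B` the Kirillov form `B x y = μ ⁅x, y⁆`
(kernel `= L^μ`, the coadjoint stabiliser), and `H` a Lie subalgebra on which `μ` vanishes.  Then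
`H` is totally isotropic for `B`, and consequently
`2 · dim H + dim L^μ ≤ dim L + 2 · dim (H ∩ L^μ)`, i.e. `dim (H ∩ L^μ) ≥ dim H − (dim L − dim L^μ)/2`.
This is the step that turns centraliser leakage into the Kirillov packing bound
`Σ dim Hᵢ ≤ (3 dim G − ind 𝔤)/2` for TPP triples of Lie subgroups (Theorem 5 of the note). -/
theorem soloLie_kirillov_leakage (μ : Module.Dual K L) (B : LinearMap.BilinForm K L)
    (hB : ∀ x y, B x y = μ ⁅x, y⁆) (H : LieSubalgebra K L) (hμ : ∀ x ∈ H, μ x = 0) :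
    2 * finrank K H.toSubmodule + finrank K (LinearMap.ker B) ≤
      finrank K L + 2 * finrank K (H.toSubmodule ⊓ LinearMap.ker B : Submodule K L) := by
  have halt : B.IsAlt := fun x => by simp [hB]
  have hrefl : B.IsRefl := halt.isRefl
  have hiso : ∀ x ∈ H.toSubmodule, ∀ y ∈ H.toSubmodule, B x y = 0 := by
    intro x hx y hy
    rw [LieSubalgebra.mem_toSubmodule] at hx hy
    rw [hB]
    exact hμ _ (H.lie_mem hx hy)
  exact soloLie_isotropic_finrank_bound B hrefl H.toSubmodule hiso

end Lie

end Summit.MatrixMultiplication.MatrixMultiplication.Theorems
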